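import Summits.BirchSwinnertonDyer.BirchSwinnertonDyer.Theorems.GoldfeldAllTwistsTwoConverseTwinAdditiveTwoPrimesTwistSelmerCount
import Summits.BirchSwinnertonDyer.BirchSwinnertonDyer.Theorems.GoldfeldAllTwistsTwoConverseTwinAdditiveInertTwistSelmer
import Summits.BirchSwinnertonDyer.BirchSwinnertonDyer.Theorems.GoldfeldAllTwistsTwoConverseTwinAdditiveSplitPrimeTwistSelmer
import HarnessLib

set_option linter.dupNamespace false -- namespace `…BirchSwinnertonDyer.BirchSwinnertonDyer…` is the cell's (D-0017 nested layout)
set_option autoImplicit false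

/-!
# Twin″ (item 19140), LINE B⁗ object X0, part a1: the `2`-isogeny Selmer set `S(−21qp, 112q²p²)` of the ODD two-prime twist
# `49a1^{(−qp)}` has order `≤ 2` (cells C4 ∪ C8: `q ≡ 7 (mod 8)`); the `7`-adic kill for the dual side

Cell `bsd-goldfeld`, seat `bsd-goldfeld-s1p-c3x` (gen 11); planner ORDER (cccxvii) «LINE B⁗ — TRANCHE 3», object X0 (discharge of X5α-χ's explicit
hypothesis `h2 : r_an(X₀(49)^{(−qp)}) = 1` on cell C4 by descent + BCST Thm. A), first file. `--supports stmt-BirchSwinnertonDyer-19140` as a HELPER.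
FACT-FREE: no print binder, no definition, no `sorry`. HONEST FRAMING: Selmer-set counts for a twist-density-ZERO two-prime family; nothing about
`L`-values; BSD is not proved by any of this.

SETTING. `E = ⟨0, −21qp, 0, 112q²p², 0⟩ : y² = x³ − 21qp·x² + 112q²p²·x` (the templates' two-torsion model of `49a1^{(−qp)}`; GOOD reduction at
`2` since `−qp ≡ 1 (mod 4)`), `S = S(−21qp, 112q²p²)`, `S′ = S(42qp, −7q²p²)`; `q ≡ 7 (mod 8)` prime with `(q/7) = −1` (so `(−7/q) = −1`,
`(7/q) = (2/q) = +1`), `p ≡ 5 (mod 8)` prime with `(−7/p) = +1` (so `(7/p) = +1`, `(2/p) = −1`), `(p/q) = −1` (so `(q/p) = −1`). NO `hcell`: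
the type (α/β) decides WHICH four classes form `S′` (`{1, −7, p, −7p}` on α, `{1, −7, −qp, 7qp}` on β), not how many.
KILL TABLE (brute-force local solubility, memo line on HOME/STATUS 2026-08-28 X0): `S`: negatives at `ℝ`; the eight `q`-classes at `q`
(`−7(p)²`-discriminant, part I `not_isSoluble_padic_of_prime_dvd_coeffs`); `2, 14` at `p` and `p, 7p, 2p, 14p` at `q` (part VIII
`not_isSoluble_padic_of_nonresidue_of_sq_dvd`: `(2/p) = −1`; `(p/q) = (2p/q) = −1` as `(2/q) = +1`) ⇒ `S ⊆ {1, 7}`. `S′`: the discriminant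
`(42qp)² + 28q²p² = 7·(16qp)²` is exactly divisible by `7`, so the eight classes `{−1, q, −p, qp}` (`(d/7) = −1`) and `{7, −7q, 7p, −7qp}`
(`(d′/7) = −1`) die at `7` (Zywina's `isSquare_zmod_of_isSoluble_padic`); `−q, 7q` die at `p` (`(−q/p) = (7q/p) = −1`); so
`S′ ⊆ {1, −7, p, −7p, −qp, 7qp}` and, `#S′` being a power of two, **`#S′ ≤ 4`**.

* §1 `not_isSoluble_seven_odd` / `…'` (the `7`-adic kill for `S(42qp, −7q²p²)`, used by part a2), `oddTwoPrimes_facts` (the symbols).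
* §2 `card_twoIsogenySelmerGroup_oddTwoPrimesTwist_le` (`#S ≤ 2`). Part a2 (`…TwinOddTwoPrimesTwistSelmerDual`): `#S′ ≤ 4`.
References: [SilvermanAEC2009] X.4.9–X.4.10; [Zywina2025] Lemma 3.1 (proof).
-/

noncomputable section

open scoped Classical

open Literature.NumberTheory.EllipticCurves
open Literature.NumberTheory.EllipticCurves.Zywina2025 (isSquare_zmod_of_isSoluble_padic)

namespace Summit.BirchSwinnertonDyer.BirchSwinnertonDyer.Theorems.GoldfeldGoodTwists

section OddSelmer
variable {q p : ℕ} [Fact q.Prime] [Fact p.Prime]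

/-- A natural number not divisible by the prime `ℓ` is non-zero in `ZMod ℓ`, as an integer cast. [folklore] -/
private theorem intCast_ne_zero_of_not_dvd_odd {l : ℕ} [Fact l.Prime] {n : ℕ} (h : ¬ l ∣ n) : ((n : ℤ) : ZMod l) ≠ 0 := by
  rw [Int.cast_natCast, Ne, ZMod.natCast_eq_zero_iff]; exact h

/-- `ℓ ∤ 2^a · 7^b` for a prime `ℓ ∉ {2, 7}`. [folklore] -/
private theorem not_dvd_two_pow_mul_seven_pow_odd {l : ℕ} (hl : l.Prime) (hl2 : l ≠ 2) (hl7 : l ≠ 7) (a b : ℕ) :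
    ¬ l ∣ 2 ^ a * 7 ^ b := by
  intro h
  rcases (Nat.Prime.dvd_mul hl).mp h with h | h
  · exact hl2 ((Nat.prime_dvd_prime_iff_eq hl Nat.prime_two).mp (hl.dvd_of_dvd_pow h))
  · exact hl7 ((Nat.prime_dvd_prime_iff_eq hl (by norm_num)).mp (hl.dvd_of_dvd_pow h))

/-- `7 ∤ a`, `7 ∤ b` ⇒ `7 ∤ ab`. [folklore] -/
theorem not_seven_dvd_mul_oddTwoPrimes {a b : ℤ} (ha : ¬ (7 : ℤ) ∣ a) (hb : ¬ (7 : ℤ) ∣ b) : ¬ (7 : ℤ) ∣ a * b := fun h ↦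
  ((Int.prime_iff_natAbs_prime.mpr (by norm_num) : Prime (7 : ℤ)).dvd_or_dvd h).elim ha hb

/-! ## §1 The `7`-adic kill for `S′ = S(42qp, −7q²p²)` and the family's symbols -/

omit [Fact q.Prime] [Fact p.Prime] in
/-- **The `7`-adic kill** for `S(42qp, −7q²p²)`, `7 ∤ qp`: the discriminant `(42qp)² + 28q²p² = 1792·q²p² = 7·(16qp)²` is exactly divisible by
`7`, so a class `d` with `7 ∤ d` and `(d/7) = −1` has no `ℚ₇`-point. [cite: Zywina2025, Lemma 3.1 (proof)] -/
theorem not_isSoluble_seven_odd (h7qp : ¬ 7 ∣ q * p) {x y : ℤ} (hxy : x * y = -7 * ((q : ℤ) * p) ^ 2)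
    (hx : ¬ (7 : ℤ) ∣ x) (hleg : legendreSym 7 x = -1) :
    ¬ ((twoIsogenyQuartic (42 * ((q : ℤ) * p)) x y).map (Int.castRingHom ℚ_[7])).IsSoluble := by
  haveI : Fact (Nat.Prime 7) := ⟨by norm_num⟩
  intro hsol
  have e1 : (42 * ((q : ℤ) * p)) ^ 2 - 4 * x * y = 1792 * ((q * p : ℕ) : ℤ) ^ 2 := by
    push_cast; linear_combination (-4 : ℤ) * hxy
  have hB1 : (7 : ℤ) ∣ (42 * ((q : ℤ) * p)) ^ 2 - 4 * x * y := by rw [e1]; exact ⟨256 * ((q * p : ℕ) : ℤ) ^ 2, by ring⟩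
  have hB2 : ¬ (7 : ℤ) ^ 2 ∣ (42 * ((q : ℤ) * p)) ^ 2 - 4 * x * y := by rw [e1]; exact not_sq_seven_dvd_of_not_dvd h7qp
  exact (legendreSym.eq_neg_one_iff 7).mp hleg (isSquare_zmod_of_isSoluble_padic (p := 7) (by norm_num) hx hB1 hB2 hsol).2

omit [Fact q.Prime] [Fact p.Prime] in
/-- The same with the roles of `d, d′` exchanged (classes `7 ∣ d`: test `d′`). [cite: Zywina2025, Lemma 3.1 (proof)] -/
theorem not_isSoluble_seven_odd' (h7qp : ¬ 7 ∣ q * p) {x y : ℤ} (hxy : x * y = -7 * ((q : ℤ) * p) ^ 2)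
    (hy : ¬ (7 : ℤ) ∣ y) (hleg : legendreSym 7 y = -1) :
    ¬ ((twoIsogenyQuartic (42 * ((q : ℤ) * p)) x y).map (Int.castRingHom ℚ_[7])).IsSoluble := fun hsol ↦
  not_isSoluble_seven_odd h7qp (by rw [mul_comm]; exact hxy) hy hleg ((isSoluble_map_twoIsogenyQuartic_comm _ _ _ _).mp hsol)

/-- The family's symbols and non-vanishings (`q ≡ 7 (8)`, `(q/7) = −1`; `p ≡ 5 (8)`, `(−7/p) = 1`; `(p/q) = −1`): `q, p ∉ {2, 7}` distinct, `7 ∤ qp`,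
`(q/7)_L = −1`, `(p/7)_L = 1`, `(2/p) = −1`, `(7/p) = (−1/p) = 1`, `(q/p) = −1`, `(7/q) = (2/q) = 1`, `(−7/q) = (p/q) = −1`. [folklore] -/
theorem oddTwoPrimes_facts (hq8 : q % 8 = 7) (hq7 : jacobiSym q 7 = -1) (hp8 : p % 8 = 5) (hp7 : legendreSym p (-7) = 1)
    (hpq : jacobiSym p q = -1) :
    (q ≠ 2 ∧ p ≠ 2 ∧ q ≠ p ∧ ¬ 7 ∣ q * p ∧ ¬ (7 : ℤ) ∣ q ∧ ¬ (7 : ℤ) ∣ p) ∧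
    (legendreSym 7 q = -1 ∧ legendreSym 7 p = 1 ∧ ((q : ℤ) : ZMod 7) ≠ 0 ∧ ((p : ℤ) : ZMod 7) ≠ 0) ∧
    (legendreSym p 2 = -1 ∧ legendreSym p 7 = 1 ∧ legendreSym p (-1) = 1 ∧ legendreSym p q = -1) ∧
    (legendreSym q 7 = 1 ∧ legendreSym q (-7) = -1 ∧ legendreSym q 2 = 1 ∧ legendreSym q p = -1) ∧
    (((q : ℤ) : ZMod p) ≠ 0 ∧ ((p : ℤ) : ZMod q) ≠ 0) := by
  have hq : q.Prime := Fact.out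
  have hp : p.Prime := Fact.out
  haveI : Fact (Nat.Prime 7) := ⟨by norm_num⟩
  have hq4 : q % 4 = 3 := by omega
  have hq2 : q ≠ 2 := by rintro rfl; norm_num at hq8
  have hp2 : p ≠ 2 := by rintro rfl; norm_num at hp8
  have hqp : q ≠ p := by rintro rfl; omega
  have hq7' : q ≠ 7 := by rintro rfl; rw [jacobiSym.mod_left] at hq7; norm_num at hq7
  have hp7' : p ≠ 7 := by rintro rfl; norm_num at hp8
  have h7Q : ¬ (7 : ℤ) ∣ q := fun h ↦ hq7' ((Nat.prime_dvd_prime_iff_eq (by norm_num) hq).mp (by exact_mod_cast h)).symm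
  have h7P : ¬ (7 : ℤ) ∣ p := fun h ↦ hp7' ((Nat.prime_dvd_prime_iff_eq (by norm_num) hp).mp (by exact_mod_cast h)).symm
  have h7qp : ¬ 7 ∣ q * p := fun h ↦ ((Nat.Prime.dvd_mul (by norm_num)).mp h).elim (fun h ↦ h7Q (by exact_mod_cast h))
    (fun h ↦ h7P (by exact_mod_cast h))
  obtain ⟨h2p, h7p, hm1p⟩ := legendreSym_two_seven_neg_one_of_five_mod_eight hp8 hp7
  obtain ⟨hqp_p, hpq_q⟩ := legendreSym_swap_of_one_mod_four (q := q) (p := p) (by omega) hqp hq2 hpq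
  obtain ⟨h7q, hm7q⟩ := legendreSym_seven_and_neg_seven_of_three_mod_four hq4 hq7
  have h7_q : legendreSym 7 q = -1 := by rw [jacobiSym.legendreSym.to_jacobiSym]; exact_mod_cast hq7
  have h7_p : legendreSym 7 p = 1 := by
    rw [legendreSym.quadratic_reciprocity_one_mod_four (by omega : p % 4 = 1) (by norm_num : 7 ≠ 2)]; exact h7p
  have hq07 : ((q : ℤ) : ZMod 7) ≠ 0 := by rw [Ne, ZMod.intCast_zmod_eq_zero_iff_dvd]; exact_mod_cast h7Q
  have hp07 : ((p : ℤ) : ZMod 7) ≠ 0 := by rw [Ne, ZMod.intCast_zmod_eq_zero_iff_dvd]; exact_mod_cast h7P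
  have h2q : legendreSym q 2 = 1 := by
    rw [legendreSym.at_two hq2, ZMod.χ₈_nat_eq_if_mod_eight]; simp [hq8, show q % 2 = 1 by omega]
  have hqp0 : ((q : ℤ) : ZMod p) ≠ 0 :=
    intCast_ne_zero_of_not_dvd_odd (l := p) (fun h ↦ hqp ((Nat.prime_dvd_prime_iff_eq hp hq).mp h).symm)
  have hpq0 : ((p : ℤ) : ZMod q) ≠ 0 :=
    intCast_ne_zero_of_not_dvd_odd (l := q) (fun h ↦ hqp ((Nat.prime_dvd_prime_iff_eq hq hp).mp h))
  exact ⟨⟨hq2, hp2, hqp, h7qp, h7Q, h7P⟩, ⟨h7_q, h7_p, hq07, hp07⟩, ⟨h2p, h7p, hm1p, hqp_p⟩, ⟨h7q, hm7q, h2q, hpq_q⟩, ⟨hqp0, hpq0⟩⟩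

/-! ## §2 `#S(−21qp, 112q²p²) ≤ 2`: `S ⊆ {1, 7}` -/

set_option maxHeartbeats 400000 in -- sixteen positive classes, each with its local computation (as T3-D part 2)
/-- **`#S(−21qp, 112q²p²) ≤ 2`** for `q ≡ 7 (8)` prime, `(q/7) = −1`, `p ≡ 5 (8)` prime, `(−7/p) = 1`, `(p/q) = −1`: `S ⊆ {1, 7}`.
[cite: SilvermanAEC2009, Prop. X.4.9 and Example X.4.10] -/
theorem card_twoIsogenySelmerGroup_oddTwoPrimesTwist_le (hq8 : q % 8 = 7) (hq7 : jacobiSym q 7 = -1) (hp8 : p % 8 = 5)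
    (hp7 : legendreSym p (-7) = 1) (hpq : jacobiSym p q = -1) :
    (twoIsogenySelmerGroup (-21 * ((q : ℤ) * p)) (112 * ((q : ℤ) * p) ^ 2)).card ≤ 2 := by
  have hq : q.Prime := Fact.out
  have hp : p.Prime := Fact.out
  have hqZ : Prime (q : ℤ) := Nat.prime_iff_prime_int.mp hq
  have hpZ : Prime (p : ℤ) := Nat.prime_iff_prime_int.mp hp
  have hq0 : (q : ℤ) ≠ 0 := by exact_mod_cast hq.ne_zero
  have hp0 : (p : ℤ) ≠ 0 := by exact_mod_cast hp.ne_zero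
  obtain ⟨⟨hq2, hp2, hqp, -, -, -⟩, -, ⟨h2p, h7p, -, hqp_p⟩, ⟨h7q, hm7q, h2q, hpq_q⟩, ⟨hqp0, hpq0⟩⟩ := oddTwoPrimes_facts hq8 hq7 hp8 hp7 hpq
  have hq7' : q ≠ 7 := by rintro rfl; rw [jacobiSym.mod_left] at hq7; norm_num at hq7
  have hp7' : p ≠ 7 := by rintro rfl; norm_num at hp8
  have hcq : ∀ a b : ℕ, (((2 ^ a * 7 ^ b : ℕ) : ℤ) : ZMod q) ≠ 0 := fun a b ↦
    intCast_ne_zero_of_not_dvd_odd (not_dvd_two_pow_mul_seven_pow_odd hq hq2 hq7' a b)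
  have hcp : ∀ a b : ℕ, (((2 ^ a * 7 ^ b : ℕ) : ℤ) : ZMod p) ≠ 0 := fun a b ↦
    intCast_ne_zero_of_not_dvd_odd (not_dvd_two_pow_mul_seven_pow_odd hp hp2 hp7' a b)
  have h4q : ((4 : ℤ) : ZMod q) ≠ 0 := by have := hcq 2 0; norm_num at this; exact_mod_cast this
  have h2q0 : ((2 : ℤ) : ZMod q) ≠ 0 := by have := hcq 1 0; norm_num at this; exact_mod_cast this
  have hpq' : (((p : ℤ) : ℤ) : ZMod q) ≠ 0 := hpq0
  have h2qp : ((2 * q : ℤ) : ZMod p) ≠ 0 := by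
    have h2 := hcp 1 0; norm_num at h2; push_cast; exact mul_ne_zero (by exact_mod_cast h2) (by exact_mod_cast hqp0)
  have h4qp : ((4 * q : ℤ) : ZMod p) ≠ 0 := by
    have h4 := hcp 2 0; norm_num at h4; push_cast; exact mul_ne_zero (by exact_mod_cast h4) (by exact_mod_cast hqp0)
  have hpq4 : ((p : ℤ) : ZMod q) ≠ 0 := hpq0
  -- the non-residues
  have hns_p_q : ¬ IsSquare (((p : ℤ)) : ZMod q) := (legendreSym.eq_neg_one_iff q).mp hpq_q
  have hns_7p_q : ¬ IsSquare (((7 * p : ℤ)) : ZMod q) :=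
    (legendreSym.eq_neg_one_iff q).mp (by rw [legendreSym.mul, h7q, hpq_q]; norm_num)
  have hns_2p_q : ¬ IsSquare ((((p : ℤ) * 2 : ℤ)) : ZMod q) :=
    (legendreSym.eq_neg_one_iff q).mp (by rw [legendreSym.mul, hpq_q, h2q]; norm_num)
  have hns_14p_q : ¬ IsSquare ((((p : ℤ) * 14 : ℤ)) : ZMod q) :=
    (legendreSym.eq_neg_one_iff q).mp (by
      rw [show ((p : ℤ) * 14 : ℤ) = p * 7 * 2 by ring, legendreSym.mul, legendreSym.mul, hpq_q, h7q, h2q]; norm_num)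
  have hns_112p_q : ¬ IsSquare (((112 * p : ℤ)) : ZMod q) := by
    rw [show (112 * p : ℤ) = 7 * p * 4 ^ 2 by ring]; exact not_isSquare_mul_sq_zmod h4q hns_7p_q
  have hns_16p_q : ¬ IsSquare (((16 * p : ℤ)) : ZMod q) := by
    rw [show (16 * p : ℤ) = p * 4 ^ 2 by ring]; exact not_isSquare_mul_sq_zmod h4q hns_p_q
  have hns_56p_q : ¬ IsSquare (((56 * p : ℤ)) : ZMod q) := by
    rw [show (56 * p : ℤ) = p * 14 * 2 ^ 2 by ring]; exact not_isSquare_mul_sq_zmod h2q0 hns_14p_q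
  have hns_8p_q : ¬ IsSquare (((8 * p : ℤ)) : ZMod q) := by
    rw [show (8 * p : ℤ) = p * 2 * 2 ^ 2 by ring]; exact not_isSquare_mul_sq_zmod h2q0 hns_2p_q
  have hns_2_p : ¬ IsSquare (((2 : ℤ)) : ZMod p) := (legendreSym.eq_neg_one_iff p).mp h2p
  have hns_14_p : ¬ IsSquare (((14 : ℤ)) : ZMod p) :=
    (legendreSym.eq_neg_one_iff p).mp (by rw [show (14 : ℤ) = 2 * 7 by norm_num, legendreSym.mul, h2p, h7p]; norm_num)
  have hns_56qq_p : ¬ IsSquare (((56 * q ^ 2 : ℤ)) : ZMod p) := by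
    rw [show (56 * q ^ 2 : ℤ) = 14 * (2 * q) ^ 2 by ring]; exact not_isSquare_mul_sq_zmod h2qp hns_14_p
  have hns_8qq_p : ¬ IsSquare (((8 * q ^ 2 : ℤ)) : ZMod p) := by
    rw [show (8 * q ^ 2 : ℤ) = 2 * (2 * q) ^ 2 by ring]; exact not_isSquare_mul_sq_zmod h2qp hns_2_p
  have hns_disc_q : ¬ IsSquare ((((-21 * p) ^ 2 - 4 * (112 * p ^ 2) : ℤ)) : ZMod q) := by
    rw [show ((-21 * p) ^ 2 - 4 * (112 * p ^ 2) : ℤ) = -7 * p ^ 2 by ring]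
    exact not_isSquare_mul_sq_zmod hpq4 ((legendreSym.eq_neg_one_iff q).mp hm7q)
  have hb : (112 * ((q : ℤ) * p) ^ 2 : ℤ) ≠ 0 := by positivity
  ------------------------------------------------------------------ `S ⊆ {1, 7}`
  have hsub : twoIsogenySelmerGroup (-21 * ((q : ℤ) * p)) (112 * ((q : ℤ) * p) ^ 2) ⊆ ({1, 7} : Finset ℤ) := by
    intro d hd
    rw [mem_twoIsogenySelmerGroup_iff hb] at hd
    obtain ⟨hsqf, ⟨d', hdd'⟩, hloc⟩ := hd
    have hd'eq : (112 * ((q : ℤ) * p) ^ 2 : ℤ) / d = d' := by rw [hdd', Int.mul_ediv_cancel_left _ hsqf.ne_zero]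
    rw [hd'eq] at hloc
    obtain ⟨hreal, hpadic⟩ := hloc
    -- negatives die at `ℝ`
    have hdpos : 0 < d := by
      rcases lt_or_gt_of_ne hsqf.ne_zero with hneg | hpos
      · exfalso
        have hbpos : (0 : ℤ) < 112 * ((q : ℤ) * p) ^ 2 := by positivity
        have hd'neg : d' < 0 := by
          by_contra hcon
          nlinarith [mul_nonpos_iff.mpr (Or.inr ⟨hneg.le, le_of_not_gt hcon⟩)]
        have ha : (-21 * ((q : ℤ) * p)) ≤ 0 := by
          have : (0 : ℤ) ≤ (q : ℤ) * p := by positivity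
          linarith
        exact not_isSoluble_real_twoIsogenyQuartic_of_neg hneg hd'neg ha hreal
      · exact hpos
    -- the `q`-classes die at `q`
    have hqd : ¬ (q : ℤ) ∣ d := by
      rintro ⟨e, rfl⟩
      have h1 : e * d' = 112 * q * p ^ 2 := mul_left_cancel₀ hq0 (by linear_combination (-1 : ℤ) * hdd')
      have h3 : (q : ℤ) ∣ e * d' := ⟨112 * p ^ 2, by rw [h1]; ring⟩
      rcases hqZ.dvd_or_dvd h3 with h4 | h4
      · obtain ⟨e₁, rfl⟩ := h4
        exact hqZ.not_unit (hsqf (q : ℤ) ⟨e₁, by ring⟩)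
      · obtain ⟨e', rfl⟩ := h4
        have hm : e * e' = 112 * p ^ 2 := mul_left_cancel₀ hq0 (by linear_combination h1)
        exact not_isSoluble_padic_of_prime_dvd_coeffs (p := q) (c := -21 * p) (by ring) rfl rfl hm hns_disc_q (hpadic q)
    -- `d ∣ 14qp` prime to `q`: `d ∣ 14p`
    have h0 : d ∣ 112 * ((q : ℤ) * p) ^ 2 := ⟨d', hdd'⟩
    have h1 : d ∣ (14 * ((q : ℤ) * p)) ^ 4 := h0.trans ⟨343 * ((q : ℤ) * p) ^ 2, by ring⟩
    have h14qp : d ∣ 14 * ((q : ℤ) * p) := (hsqf.dvd_pow_iff_dvd (by norm_num)).mp h1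
    have hcopq : IsCoprime d (q : ℤ) := ((hqZ.irreducible.coprime_iff_not_dvd).mpr hqd).symm
    have h14p : d ∣ 14 * (p : ℤ) := by
      have : d ∣ (q : ℤ) * (14 * p) := by rw [show (q : ℤ) * (14 * p) = 14 * (q * p) by ring]; exact h14qp
      exact hcopq.dvd_of_dvd_mul_left this
    by_cases hpd : (p : ℤ) ∣ d
    · -- `d = p·e`, `e ∣ 14`, all four die at `q`
      exfalso
      obtain ⟨e, rfl⟩ := hpd
      have he14 : e ∣ 14 := by
        have : (p : ℤ) * e ∣ (p : ℤ) * 14 := by rw [mul_comm (p : ℤ) 14]; exact h14p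
        exact (mul_dvd_mul_iff_left hp0).mp this
      have hepos : 0 < e := pos_of_mul_pos_right hdpos (by positivity)
      have hele : e ≤ 14 := Int.le_of_dvd (by norm_num) he14
      have hd'e : e * d' = 112 * q ^ 2 * p := mul_left_cancel₀ hp0 (by linear_combination (-1 : ℤ) * hdd')
      interval_cases e <;> try omega
      · -- `d = p`: `d′ = q²·112p`
        exact not_isSoluble_padic_of_nonresidue_of_sq_dvd (p := q) (c := -21 * p) (e' := 112 * p) (by ring)
          (show d' = (q : ℤ) ^ 2 * (112 * p) by linarith) (by simpa using hns_p_q) hns_112p_q (hpadic q)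
      · -- `d = 2p`: `d′ = q²·56p`
        exact not_isSoluble_padic_of_nonresidue_of_sq_dvd (p := q) (c := -21 * p) (e' := 56 * p) (by ring)
          (show d' = (q : ℤ) ^ 2 * (56 * p) by linarith) hns_2p_q hns_56p_q (hpadic q)
      · -- `d = 7p`: `d′ = q²·16p`
        exact not_isSoluble_padic_of_nonresidue_of_sq_dvd (p := q) (c := -21 * p) (e' := 16 * p) (by ring)
          (show d' = (q : ℤ) ^ 2 * (16 * p) by linarith)
          (by rw [show ((p : ℤ) * 7 : ℤ) = (7 * p : ℤ) by ring]; exact hns_7p_q) hns_16p_q (hpadic q)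
      · -- `d = 14p`: `d′ = q²·8p`
        exact not_isSoluble_padic_of_nonresidue_of_sq_dvd (p := q) (c := -21 * p) (e' := 8 * p) (by ring)
          (show d' = (q : ℤ) ^ 2 * (8 * p) by linarith) hns_14p_q hns_8p_q (hpadic q)
    · -- `d ∣ 14`
      have hcopp : IsCoprime d (p : ℤ) := ((hpZ.irreducible.coprime_iff_not_dvd).mpr hpd).symm
      have hd14 : d ∣ 14 := hcopp.dvd_of_dvd_mul_right h14p
      have hle : d ≤ 14 := Int.le_of_dvd (by norm_num) hd14
      have hne2 : d ≠ 2 := by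
        rintro rfl
        exact not_isSoluble_padic_of_nonresidue_of_sq_dvd (p := p) (c := -21 * q) (e' := 56 * q ^ 2) (by ring)
          (show d' = (p : ℤ) ^ 2 * (56 * q ^ 2) by linarith) hns_2_p hns_56qq_p (hpadic p)
      have hne14 : d ≠ 14 := by
        rintro rfl
        exact not_isSoluble_padic_of_nonresidue_of_sq_dvd (p := p) (c := -21 * q) (e' := 8 * q ^ 2) (by ring)
          (show d' = (p : ℤ) ^ 2 * (8 * q ^ 2) by linarith) hns_14_p hns_8qq_p (hpadic p)
      interval_cases d <;> first | (exfalso; omega) | simp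
  exact (Finset.card_le_card hsub).trans Finset.card_le_two

end OddSelmer

end Summit.BirchSwinnertonDyer.BirchSwinnertonDyer.Theorems.GoldfeldGoodTwists

end
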